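import Summits.CriticalPhenomena.PercolationContinuityZ3.Theorems.PercNearOneGluingNoHeavyLowerTailSahiThreeCopyCellY6aMasks1
import Summits.CriticalPhenomena.PercolationContinuityZ3.Theorems.PercNearOneGluingNoHeavyLowerTailSahiThreeCopyHitPairsSix

/-!
# `NoHeavyLowerTail` (crux stmt-CriticalPhenomena-4575), Sahi programme: ★★★ **`LawGood 6 π 1_{Y6a}` AT EVERY FRONT PROFILE**

Support file (Sahi cell, seat `prim-sahi-p1`, generation 65; `--supports stmt-CriticalPhenomena-4575`).  Assembly: the interior table (masks `prof6 m`,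
`…CellY6aMasks*`) and the boundary (up-set sections on five coordinates, `frontGood_six_of_boundary`).
COMPUTATIONAL content inherited (cell checks, section identities). [this work]
-/

namespace Summit.CriticalPhenomena.PercolationContinuityZ3.Theorems.SahiThreeCopy

open Finset Function Literature.Combinatorics.Sahi2008
open scoped BigOperators

/-- ★★ `LawGood 6 (prof6 m) 1_{Y6a}` for EVERY interior front profile (all 64 masks). [this work] -/
theorem lawGood_Y6a_prof (m : Fin 64) : LawGood 6 (prof6 m) (setInd Y6aSet) := by
  fin_cases m
  · exact lawGood_Y6a111111
  · exact lawGood_Y6a211111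
  · exact lawGood_Y6am2
  · exact lawGood_Y6am3
  · exact lawGood_Y6a112111
  · exact lawGood_Y6a212111
  · exact lawGood_Y6a122111
  · exact lawGood_Y6a222111
  · exact lawGood_Y6am8
  · exact lawGood_Y6am9
  · exact lawGood_Y6am10
  · exact lawGood_Y6am11
  · exact lawGood_Y6am12
  · exact lawGood_Y6am13
  · exact lawGood_Y6am14
  · exact lawGood_Y6am15
  · exact lawGood_Y6am16
  · exact lawGood_Y6am17
  · exact lawGood_Y6am18
  · exact lawGood_Y6am19
  · exact lawGood_Y6am20
  · exact lawGood_Y6am21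
  · exact lawGood_Y6am22
  · exact lawGood_Y6am23
  · exact lawGood_Y6am24
  · exact lawGood_Y6am25
  · exact lawGood_Y6am26
  · exact lawGood_Y6am27
  · exact lawGood_Y6am28
  · exact lawGood_Y6am29
  · exact lawGood_Y6am30
  · exact lawGood_Y6am31
  · exact lawGood_Y6a111112
  · exact lawGood_Y6a211112
  · exact lawGood_Y6am34
  · exact lawGood_Y6am35
  · exact lawGood_Y6a112112
  · exact lawGood_Y6a212112
  · exact lawGood_Y6a122112
  · exact lawGood_Y6a222112
  · exact lawGood_Y6am40
  · exact lawGood_Y6am41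
  · exact lawGood_Y6am42
  · exact lawGood_Y6am43
  · exact lawGood_Y6am44
  · exact lawGood_Y6am45
  · exact lawGood_Y6am46
  · exact lawGood_Y6am47
  · exact lawGood_Y6a111122
  · exact lawGood_Y6a211122
  · exact lawGood_Y6am50
  · exact lawGood_Y6am51
  · exact lawGood_Y6a112122
  · exact lawGood_Y6a212122
  · exact lawGood_Y6a122122
  · exact lawGood_Y6a222122
  · exact lawGood_Y6a111222
  · exact lawGood_Y6a211222
  · exact lawGood_Y6am58
  · exact lawGood_Y6am59
  · exact lawGood_Y6a112222
  · exact lawGood_Y6a212222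
  · exact lawGood_Y6a122222
  · exact lawGood_Y6a222222

/-- ★★★ **`LawGood 6 π 1_{Y6a}` at EVERY front profile** (interior: the table; boundary: sections are up-sets on five coordinates). [this work] -/
theorem lawGood_Y6a_all (π : Fin 6 → ℕ) : LawGood 6 π (setInd Y6aSet) :=
  lawGood_all_of_interior_of_boundary (k := 6) (f := setInd Y6aSet)
    (fun m hm => lawGood_Y6a_prof ⟨m, hm⟩)
    (fun π i hi => lawGood_of_frontGood (frontGood_six_of_boundary π i hi isUpperSet_Y6aSet)) π

end Summit.CriticalPhenomena.PercolationContinuityZ3.Theorems.SahiThreeCopy
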